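import Literature.NumberTheory.Rogawski1990.ArchDeltaTransferCongruence          -- ★ (T-d) FILE 5: `isArchNormPair_of_archCongr`, `isArchNormPair_archCongr_symm_iff`, `archTransferFactor_comap_Δ`
import Literature.NumberTheory.Rogawski1990.ArchEndoscopicStableClassCompactH     -- ★ (3R-H): `isCompact_centralizer_of_isCompact_centralizer_archCongr`
import Literature.NumberTheory.Automorphic.ArchCongruenceOrbitalTransport         -- ★ (T-d) FILE 1: `integral_comp_conj_map_continuousMulEquiv`
import Mathlib.MeasureTheory.Group.Integral
import HarnessLib

/-!
# The `G′`-side of (4.3.1) at `∞` in Haar currency is carried by an archimedean congruence: `Σ_{[γ′]} Δ′_∞(γ_H, γ′)·∫_{G′_∞} a′(g γ′ g⁻¹) dν′`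
# read on `U(H₂)(L ⊗ ℝ)` along `Φ : U(H₂)(L ⊗ ℝ) ≃ₜ* U(H)(L ⊗ ℝ)`, `g ↦ T g T⁻¹` (Rogawski 1990 §14.4 p. 237 «`f_v = f′_v ∘ ψ_v⁻¹`»; §4.3 (4.3.1) p. 43)

Topic `NumberTheory/Rogawski1990`; namespace `Literature.NumberTheory.Rogawski1990`.  THEOREMS ONLY (no `def`, no instance, no notation, no axiom, no named fact, no `sorry`).
Cell `pub/hodgecm-mathlib`, ENGINE T1 (crux H413 = `stmt-HodgeConjecture-24833`); ROAD-Sd residual R3 «(S-c) central vanishing» (`stub_ScCore` of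
`Cruxes/H413/Lines/F0_P3a_SdArch.lean`), STEP 3 of the integration census `CENSUS-R3-STEP3-Integration` (pen of record F0P3a-p03; LEAD WORDS T8-76 (C), T8-92 (1)):
node (3T), TRANSPORT HALF — FILE (α) of the 3Z assembly; author F0P3a-p03 (g11), 2026-09-01.

WHY.  ★ (E1) `finsum_integral_comp_conj_eq_finsum_delta_mul_integral_comp_conj_of_isArchDeltaTransfer` reads (vi) at a `G`-regular `γ_H` in HAAR currency in the frame `(L, H′)` of the letter:
its `G′`-side is `∑ᶠ c′ : ConjClasses U(H′)_∞, Δ′(γ_H, out c′) · ∫_{U(H′)_∞} a′(g·out c′·g⁻¹) dν′`.  The flatness of this quantity along the central curve (★ (3G) `exists_flat_gSide_centralCurve`)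
is proved on the DIAGONAL frame `U(diagonal α′)(L ⊗ ℝ)` reached by a rational congruence `Φ = Φ_P` (★ `exists_formCongr_eq_diagonal`, ★ FILE 1 `coe_archCongrOfEq_apply`).  This file moves the
sum across `Φ` for ANY archimedean transfer factor `Δ′` (★ `ArchTransferFactor`): the factor becomes the pulled-back one `Δ′ ∘ (id × Φ)` (★ `TransferFactorData.comap`, FILE 5
`archTransferFactor_comap_Δ`), the test function becomes `a′ ∘ Φ`, the Haar measure becomes `Φ⁻¹_* ν′`.  No explicit formula for `Δ′` is used here; the identification of the pulled-back
EXPLICIT factor `Δ″_∞ ∘ (id × Φ)` with `Δ″_∞` of the diagonal frame is node (3T-b) (`archExplicitDelta` is congruence-covariant), a separate file.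

WHAT IS PROVED (abstract frame `(T, Φ, hΦ)` as in ★ FILES 1–5).
* §1 `integral_comp_conj_comp_archCongr_map_symm` — `∫_{U(H₂)} (a′ ∘ Φ)(g·x·g⁻¹) d(Φ⁻¹_*ν′)(g) = ∫_{U(H)} a′(h·Φ x·h⁻¹) dν′(h)`; `integral_comp_conj_eq_of_isConj` — the Haar-currency orbital
  integral is a class function (right invariance).
* §2 **`finsum_delta_mul_integral_comp_conj_eq_comap`** — THE HEAD:
  `∑ᶠ c′ : ConjClasses U(H)_∞, TΔ.Δ γ_H (out c′) · ∫ a′(g·out c′·g⁻¹) dν′ = ∑ᶠ c″ : ConjClasses U(H₂)_∞, (TΔ.comap Φ _).Δ γ_H (out c″) · ∫ (a′ ∘ Φ)(g·out c″·g⁻¹) d(Φ⁻¹_*ν′)`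
  (re-index by `c″ ↦ ConjClasses.map Φ c″`, a bijection with inverse ★ `preClass`; both factors are class functions: `TΔ.conj_right`, §1).
* §3 `compactSpace_centralizer_of_isArchNormPair_of_archCongr` — the `hZ′` binder of ★ (E1) carried from `U(H₂)` to `U(H)`: if every norm partner of `γ_H` in `U(H₂)_∞` has a compact
  centraliser, so does every norm partner in `U(H)_∞` (★ FILE 5 `isArchNormPair_archCongr_symm_iff`, ★ `isCompact_centralizer_of_isCompact_centralizer_archCongr`).
HONEST LABEL: HC_CM is proved only modulo the 7 printed citations until rung 0 closes; this file is transport bookkeeping and pays nothing by itself.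

## References
* [Rogawski1990] J. D. Rogawski, *Automorphic Representations of Unitary Groups in Three Variables*, Ann. of Math. Stud. 123 (1990), §14.4 p. 237 («`f_v = f′_v ∘ ψ_v⁻¹`»), §4.3 (4.3.1)
  p. 43 (`Δ` a class function; representatives), §1.7 p. 6 (measures), §14.5 Lemma 14.5.2 (c) p. 238.
* [Folland1995] G. B. Folland, *A Course in Abstract Harmonic Analysis* (1995), §2.6 (2.52) (change of variables along a group isomorphism).
* [Gelbart1975] S. Gelbart, *Automorphic Forms on Adele Groups*, Ann. of Math. Stud. 83 (1975), §10 pp. 154–155 (classes under an isomorphism).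
* [PlatonovRapinchuk1994] V. Platonov, A. Rapinchuk, *Algebraic Groups and Number Theory* (1994), §2.3.
-/

set_option autoImplicit false

noncomputable section

open MeasureTheory Measure NumberField NumberField.InfinitePlace NumberField.mixedEmbedding Topology
open scoped Matrix MatrixGroups

namespace Literature.NumberTheory.Rogawski1990

open Literature.MeasureTheory.Group Literature.NumberTheory.Automorphic

/-! ## §1 Haar-currency orbital integrals along `Φ` and at conjugate points -/

section Generic

variable {G : Type*} [Group G] [MeasurableSpace G] [MeasurableMul G]

/-- **The Haar-currency orbital integral is a class function**: `∫ f(g·(y x y⁻¹)·g⁻¹) dν = ∫ f(g x g⁻¹) dν` for a right-invariant `ν` (substitute `g ↦ g y`).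
[cite: Rogawski1990, §4.3 p. 43] -/
theorem integral_comp_conj_conj_eq {E : Type*} [NormedAddCommGroup E] [NormedSpace ℝ E] (ν : Measure G) [ν.IsMulRightInvariant]
    (f : G → E) (x y : G) :
    ∫ g, f (g * (y * x * y⁻¹) * g⁻¹) ∂ν = ∫ g, f (g * x * g⁻¹) ∂ν := by
  calc ∫ g, f (g * (y * x * y⁻¹) * g⁻¹) ∂ν = ∫ g, (fun g' : G => f (g' * x * g'⁻¹)) (g * y) ∂ν := by
        congr 1
        funext g
        simp only [mul_assoc, mul_inv_rev]
    _ = ∫ g, f (g * x * g⁻¹) ∂ν := integral_mul_right_eq_self (fun g' : G => f (g' * x * g'⁻¹)) y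

/-- The same along `IsConj`: conjugate points have the same Haar-currency orbital integral. [cite: Rogawski1990, §4.3 p. 43] -/
theorem integral_comp_conj_eq_of_isConj {E : Type*} [NormedAddCommGroup E] [NormedSpace ℝ E] (ν : Measure G) [ν.IsMulRightInvariant]
    (f : G → E) {x x' : G} (h : IsConj x x') :
    ∫ g, f (g * x' * g⁻¹) ∂ν = ∫ g, f (g * x * g⁻¹) ∂ν := by
  obtain ⟨y, hy⟩ := isConj_iff.1 h
  rw [← hy]
  exact integral_comp_conj_conj_eq ν f x y

end Generic

section Arch

variable (L : Type) [Field L] [NumberField L] [IsCMField L] {H H₂ : Matrix (Fin 3) (Fin 3) L} (T : GL (Fin 3) (mixedSpace L))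
  (Φ : UnitaryGroup.arch (↥(maximalRealSubfield L)) L (IsCMField.complexConj L) 3 H₂ ≃ₜ* UnitaryGroup.arch (↥(maximalRealSubfield L)) L (IsCMField.complexConj L) 3 H)
  (hΦ : ∀ g : UnitaryGroup.arch (↥(maximalRealSubfield L)) L (IsCMField.complexConj L) 3 H₂,
    ((Φ g : UnitaryGroup.arch (↥(maximalRealSubfield L)) L (IsCMField.complexConj L) 3 H) : GL (Fin 3) (mixedSpace L)) = T * (g : GL (Fin 3) (mixedSpace L)) * T⁻¹)
  [MeasurableSpace (UnitaryGroup.arch (↥(maximalRealSubfield L)) L (IsCMField.complexConj L) 3 H)]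
  [BorelSpace (UnitaryGroup.arch (↥(maximalRealSubfield L)) L (IsCMField.complexConj L) 3 H)]
  [MeasurableSpace (UnitaryGroup.arch (↥(maximalRealSubfield L)) L (IsCMField.complexConj L) 3 H₂)]
  [BorelSpace (UnitaryGroup.arch (↥(maximalRealSubfield L)) L (IsCMField.complexConj L) 3 H₂)]

/-- **ORBITAL INTEGRALS OF `a′ ∘ Φ` AGAINST `Φ⁻¹_* ν′`**: `∫_{U(H₂)} (a′ ∘ Φ)(g·x·g⁻¹) d(Φ⁻¹_*ν′)(g) = ∫_{U(H)} a′(h·Φ x·h⁻¹) dν′(h)` — print's «`f_v = f′_v ∘ ψ_v⁻¹`» for Haar-currency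
orbital integrals (change of variables `h = Φ g`, ★ `integral_comp_conj_map_continuousMulEquiv` at `e := Φ⁻¹`). [cite: Rogawski1990, §14.4 p. 237] [cite: Folland1995, §2.6 (2.52)] -/
theorem integral_comp_conj_comp_archCongr_map_symm
    (ν' : Measure (UnitaryGroup.arch (↥(maximalRealSubfield L)) L (IsCMField.complexConj L) 3 H))
    (a' : UnitaryGroup.arch (↥(maximalRealSubfield L)) L (IsCMField.complexConj L) 3 H → ℂ)
    (x : UnitaryGroup.arch (↥(maximalRealSubfield L)) L (IsCMField.complexConj L) 3 H₂) :
    ∫ g, (a' ∘ Φ) (g * x * g⁻¹) ∂(ν'.map Φ.symm) = ∫ h, a' (h * Φ x * h⁻¹) ∂ν' := by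
  have h1 := integral_comp_conj_map_continuousMulEquiv Φ.symm ν' (a' ∘ Φ) (Φ x)
  rw [ContinuousMulEquiv.symm_apply_apply] at h1
  rw [h1]
  refine integral_congr_ae (Filter.Eventually.of_forall fun h => ?_)
  simp only [Function.comp_apply, ContinuousMulEquiv.apply_symm_apply]

/-! ## §2 The head: the `Δ`-weighted class sum is carried by `Φ` -/

include hΦ in
/-- **THE `G′`-SIDE OF (4.3.1) IN HAAR CURRENCY IS CARRIED BY AN ARCHIMEDEAN CONGRUENCE.**  For every archimedean transfer factor `TΔ` on `U(H)`, every right-invariant measure `ν′` on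
`U(H)(L ⊗ ℝ)`, every `a′ : U(H)(L ⊗ ℝ) → ℂ` and every `γ_H ∈ H_∞`:
`∑ᶠ c′ : ConjClasses U(H)_∞, TΔ.Δ γ_H (out c′) · ∫ a′(g·out c′·g⁻¹) dν′(g) = ∑ᶠ c″ : ConjClasses U(H₂)_∞, (TΔ.comap Φ _).Δ γ_H (out c″) · ∫ (a′ ∘ Φ)(g·out c″·g⁻¹) d(Φ⁻¹_*ν′)(g)`,
the pulled-back factor being `(γ_H, g) ↦ TΔ.Δ γ_H (Φ g)` (★ FILE 5 `archTransferFactor_comap_Δ`, norm pairs carried by ★ `isArchNormPair_of_archCongr`).  Re-index by the bijection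
`c″ ↦ ConjClasses.map Φ c″` (inverse ★ `preClass Φ`); at `c″`, `Φ (out c″)` and `out (map Φ c″)` are conjugate in `U(H)_∞`, and both factors are class functions (`TΔ.conj_right`, §1).
[cite: Rogawski1990, §14.4 p. 237; §4.3 (4.3.1) p. 43] [cite: Gelbart1975, §10 pp. 154–155] [cite: Folland1995, §2.6 (2.52)] -/
theorem finsum_delta_mul_integral_comp_conj_eq_comap (TΔ : ArchTransferFactor L H)
    (ν' : Measure (UnitaryGroup.arch (↥(maximalRealSubfield L)) L (IsCMField.complexConj L) 3 H)) [ν'.IsMulRightInvariant]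
    (a' : UnitaryGroup.arch (↥(maximalRealSubfield L)) L (IsCMField.complexConj L) 3 H → ℂ)
    (γH : UnitaryGroup.arch (↥(maximalRealSubfield L)) L (IsCMField.complexConj L) 2 (Matrix.of fun i j : Fin 2 => if i.val + j.val + 1 = 2 then (1 : L) else 0) ×
      UnitaryGroup.arch (↥(maximalRealSubfield L)) L (IsCMField.complexConj L) 1 (Matrix.of fun i j : Fin 1 => if i.val + j.val + 1 = 1 then (1 : L) else 0)) :
    ∑ᶠ c' : ConjClasses (UnitaryGroup.arch (↥(maximalRealSubfield L)) L (IsCMField.complexConj L) 3 H),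
        TΔ.Δ γH (Quotient.out c') * ∫ g, a' (g * Quotient.out c' * g⁻¹) ∂ν' =
      ∑ᶠ c'' : ConjClasses (UnitaryGroup.arch (↥(maximalRealSubfield L)) L (IsCMField.complexConj L) 3 H₂),
        (TΔ.comap Φ.toMulEquiv (isArchNormPair_of_archCongr L T Φ hΦ) : ArchTransferFactor L H₂).Δ γH (Quotient.out c'') *
          ∫ g, (a' ∘ Φ) (g * Quotient.out c'' * g⁻¹) ∂(ν'.map Φ.symm) := by
  -- the bijection `c″ ↦ map Φ c″` on classes, inverse `preClass Φ`
  have hbij : Function.Bijective (fun c'' : ConjClasses (UnitaryGroup.arch (↥(maximalRealSubfield L)) L (IsCMField.complexConj L) 3 H₂) => c''.map Φ.toMulEquiv.toMonoidHom) := by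
    refine ⟨fun c₁ c₂ h => ?_, fun c' => ⟨preClass Φ.toMulEquiv c', map_preClass Φ.toMulEquiv c'⟩⟩
    have h' : (c₁.map Φ.toMulEquiv.toMonoidHom) = (c₂.map Φ.toMulEquiv.toMonoidHom) := h
    rw [← preClass_map Φ.toMulEquiv c₁, ← preClass_map Φ.toMulEquiv c₂, h']
  symm
  refine finsum_eq_of_bijective _ hbij fun c'' => ?_
  -- at `c″`: `Φ (out c″) ∼ out (map Φ c″)` in `U(H)_∞`
  have hconj : IsConj (Φ (Quotient.out c'')) (Quotient.out (c''.map Φ.toMulEquiv.toMonoidHom) : UnitaryGroup.arch (↥(maximalRealSubfield L)) L (IsCMField.complexConj L) 3 H) := by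
    rw [← ConjClasses.mk_eq_mk_iff_isConj]
    have h1 : ConjClasses.mk (Quotient.out (c''.map Φ.toMulEquiv.toMonoidHom)) = c''.map Φ.toMulEquiv.toMonoidHom := Quotient.out_eq _
    have h2 : c''.map Φ.toMulEquiv.toMonoidHom = ConjClasses.mk (Φ (Quotient.out c'')) := by
      conv_lhs => rw [← Quotient.out_eq c'']
      rfl
    rw [h1, h2]
  obtain ⟨y, hy⟩ := isConj_iff.1 hconj
  rw [archTransferFactor_comap_Δ, integral_comp_conj_comp_archCongr_map_symm L Φ ν' a' (Quotient.out c''), ← hy, TΔ.conj_right,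
    integral_comp_conj_conj_eq ν' a' (Φ (Quotient.out c'')) y]

/-! ## §3 The `hZ′` binder of ★ (E1) carried by `Φ` -/

include hΦ in
omit [MeasurableSpace (UnitaryGroup.arch (↥(maximalRealSubfield L)) L (IsCMField.complexConj L) 3 H)]
  [BorelSpace (UnitaryGroup.arch (↥(maximalRealSubfield L)) L (IsCMField.complexConj L) 3 H)]
  [MeasurableSpace (UnitaryGroup.arch (↥(maximalRealSubfield L)) L (IsCMField.complexConj L) 3 H₂)]
  [BorelSpace (UnitaryGroup.arch (↥(maximalRealSubfield L)) L (IsCMField.complexConj L) 3 H₂)] in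
/-- **COMPACT CENTRALISERS OF NORM PARTNERS ARE CARRIED BY `Φ`**: if every norm partner of `γ_H` in `U(H₂)(L ⊗ ℝ)` has a compact centraliser, then so does every norm partner `γ′` of `γ_H`
in `U(H)(L ⊗ ℝ)` — `Φ⁻¹ γ′` is a norm partner (★ FILE 5 `isArchNormPair_archCongr_symm_iff`) and `Z(γ′) = Φ(Z(Φ⁻¹ γ′))` (★ `isCompact_centralizer_of_isCompact_centralizer_archCongr` along `Φ⁻¹`).
This is the `hZ′` binder of ★ (E1) `finsum_integral_comp_conj_eq_finsum_delta_mul_integral_comp_conj_of_isArchDeltaTransfer` in the frame `H`, from the diagonal frame `H₂`.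
[cite: Rogawski1990, §14.3 p. 234; §14.4 p. 237] [cite: PlatonovRapinchuk1994, §2.3] -/
theorem compactSpace_centralizer_of_isArchNormPair_of_archCongr
    (γH : UnitaryGroup.arch (↥(maximalRealSubfield L)) L (IsCMField.complexConj L) 2 (Matrix.of fun i j : Fin 2 => if i.val + j.val + 1 = 2 then (1 : L) else 0) ×
      UnitaryGroup.arch (↥(maximalRealSubfield L)) L (IsCMField.complexConj L) 1 (Matrix.of fun i j : Fin 1 => if i.val + j.val + 1 = 1 then (1 : L) else 0))
    (hZ₂ : ∀ g : UnitaryGroup.arch (↥(maximalRealSubfield L)) L (IsCMField.complexConj L) 3 H₂, IsArchNormPair L H₂ γH g →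
      CompactSpace (Subgroup.centralizer ({g} : Set (UnitaryGroup.arch (↥(maximalRealSubfield L)) L (IsCMField.complexConj L) 3 H₂))))
    (γ' : UnitaryGroup.arch (↥(maximalRealSubfield L)) L (IsCMField.complexConj L) 3 H) (hnp : IsArchNormPair L H γH γ') :
    CompactSpace (Subgroup.centralizer ({γ'} : Set (UnitaryGroup.arch (↥(maximalRealSubfield L)) L (IsCMField.complexConj L) 3 H))) := by
  have hnp₂ : IsArchNormPair L H₂ γH (Φ.symm γ') := (isArchNormPair_archCongr_symm_iff L T Φ hΦ γH γ').2 hnp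
  haveI := hZ₂ _ hnp₂
  exact isCompact_iff_compactSpace.1 (isCompact_centralizer_of_isCompact_centralizer_archCongr L Φ.symm γ' (isCompact_iff_compactSpace.2 this))

end Arch

end Literature.NumberTheory.Rogawski1990

end
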